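import Literature.NumberTheory.LFunctions.FeketePolyaKernelCertificatesBlockWrappers
import HarnessLib

/-!
# No real zero for real primitive characters of conductor `7752 ≤ q ≤ 9676`: the Fekete–Pólya rows, in the kernel (rows deferred by the earlier engines)

Topic `Literature/NumberTheory/LFunctions`; namespace `Literature.NumberTheory.LFunctions`. THEOREMS only (no
definition, no named fact, no `sorry`; standard axioms): one PUBLIC theorem **`noRealZero{Odd,Even}_fp_<q>`** per
fundamental discriminant `D`, `|D| = q ∈ [7752, 9676]`, that admits a Fekete–Pólya witness but was DEFERRED by the per-position engines v1/v2 (walk too long for one `decide`) — for every primitive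
quadratic `χ` mod `q` of the parity of `D` and every `σ ∈ (0, 1)`, `L(σ, χ) ≠ 0` (statement shape of the
`interval_cases` bullets of the `NoRealZero{Odd,Even}…` range files, so a range assembly cites them by name).
Cell `parity-realchar`, kernel floor of the wide column (TARGET §2 row 19), Fekete–Pólya lane (seat prover-2).

Method (engine v4): `FeketePolyaKernelCertificatesBlock{,Wrappers}.lean` — the iterated partial sums of order
`K` of the induced character `χ↑(q·w)` are non-negative over one period, decided in the kernel BLOCKWISE on packed
base-`2^b` digits (`blockCert b B K (q·w) (tabs… b ps q w)`: sign tables of the character from the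
quadratic-residue bitsets of the prime factors of the conductor — the factor list is part of each certificate,
primality by `norm_num` — prefix sums by one big-integer multiplication per order and block, sign test by one
AND), hence `ℜL(σ, χ↑(q·w)) > 0` (Fekete–Pólya 1912 / MV §11.2.1 Exercise 7) and `L(σ, χ) ≠ 0` (positive Euler
factors, Exercise 8).  Witnesses `(w, K)` = the cheapest in the exact integer scan of this seat
(`HOME/parity-realchar-prover-2/fp-witnesses-*.tsv`; no kit); the digit width `b` is two bits above the size of
the running-sum bound recorded by the scan.  11 characters in this file (est. 80 kernel-s).
NOT covered here (no Fekete–Pólya witness with `w ≤ 40`, `q·w ≤ 4·10⁵`, `K ≤ 12`; the other Fekete–Pólya rows of this range are in the `NoRealZeroFeketePolyaX…` files) — left to the truncation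
certificates of the companion lane: see those files.

## References

* H. L. Montgomery, R. C. Vaughan, *Multiplicative Number Theory I*, CUP 2007, §9.3 Thm 9.13, §11.2.1
  Exercises 7–8. [MontgomeryVaughan2007]
* M. Fekete, G. Pólya, *Über ein Problem von Laguerre*, Rend. Circ. Mat. Palermo 34 (1912) 89–120. [FeketePolya1912]
-/

namespace Literature.NumberTheory.LFunctions

open FeketePolyaKernel

set_option maxHeartbeats 400000 in
/-- `D = 7752`: the even character `χ₈·(·/969)` of conductor `7752` (`969`: 3 · 17 · 19) — Fekete–Pólya witness of order `8` along the induced modulus `7752·35 = 271320`, block certificate (digits of `121` bits, splitting depth `11`); est. `12.0` kernel-s. [cite: MontgomeryVaughan2007, §11.2.1 Exercises 7 (g), 8] -/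
theorem noRealZeroEven_fp_7752 :
    ∀ χ : DirichletCharacter ℂ 7752, χ.IsQuadratic → χ.IsPrimitive → χ.Even →
      ∀ σ : ℝ, 0 < σ → σ < 1 → χ.LFunction σ ≠ 0 :=
  good_even_of_eight_blk [3, 17, 19] (by norm_num) (by decide) (by decide) 35 8 121 11 (by decide) (by decide) (by decide)
    (Or.inl (by decide +kernel)) (Or.inr (by decide +kernel))

set_option maxHeartbeats 400000 in
/-- `D = -7899`: the odd character `(·/7899)` of conductor `7899` (`7899`: 3 · 2633) — Fekete–Pólya witness of order `5` along the induced modulus `7899·22 = 173778`, block certificate (digits of `74` bits, splitting depth `10`); est. `4.3` kernel-s. [cite: MontgomeryVaughan2007, §11.2.1 Exercises 7 (g), 8] -/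
theorem noRealZeroOdd_fp_7899 :
    ∀ χ : DirichletCharacter ℂ 7899, χ.IsQuadratic → χ.IsPrimitive → χ.Odd →
      ∀ σ : ℝ, 0 < σ → σ < 1 → χ.LFunction σ ≠ 0 :=
  good_odd_of_odd_blk [3, 2633] (by norm_num) (by decide) (by decide) 22 5 74 10 (by decide) (by decide) (by decide)
    (Or.inr (by decide +kernel))

set_option maxHeartbeats 400000 in
/-- `D = 7949`: the even character `(·/7949)` of conductor `7949` (`7949`: prime) — Fekete–Pólya witness of order `8` along the induced modulus `7949·22 = 174878`, block certificate (digits of `117` bits, splitting depth `10`); est. `8.1` kernel-s. [cite: MontgomeryVaughan2007, §11.2.1 Exercises 7 (g), 8] -/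
theorem noRealZeroEven_fp_7949 :
    ∀ χ : DirichletCharacter ℂ 7949, χ.IsQuadratic → χ.IsPrimitive → χ.Even →
      ∀ σ : ℝ, 0 < σ → σ < 1 → χ.LFunction σ ≠ 0 :=
  good_even_of_odd_blk [7949] (by norm_num) (by decide) (by decide) 22 8 117 10 (by decide) (by decide) (by decide)
    (Or.inr (by decide +kernel))

set_option maxHeartbeats 400000 in
/-- `D = -8327`: the odd character `(·/8327)` of conductor `8327` (`8327`: 11 · 757) — Fekete–Pólya witness of order `5` along the induced modulus `8327·35 = 291445`, block certificate (digits of `78` bits, splitting depth `11`); est. `7.1` kernel-s. [cite: MontgomeryVaughan2007, §11.2.1 Exercises 7 (g), 8] -/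
theorem noRealZeroOdd_fp_8327 :
    ∀ χ : DirichletCharacter ℂ 8327, χ.IsQuadratic → χ.IsPrimitive → χ.Odd →
      ∀ σ : ℝ, 0 < σ → σ < 1 → χ.LFunction σ ≠ 0 :=
  good_odd_of_odd_blk [11, 757] (by norm_num) (by decide) (by decide) 35 5 78 11 (by decide) (by decide) (by decide)
    (Or.inr (by decide +kernel))

set_option maxHeartbeats 400000 in
/-- `D = -8339`: the odd character `(·/8339)` of conductor `8339` (`8339`: 31 · 269) — Fekete–Pólya witness of order `8` along the induced modulus `8339·38 = 316882`, block certificate (digits of `124` bits, splitting depth `11`); est. `14.3` kernel-s. [cite: MontgomeryVaughan2007, §11.2.1 Exercises 7 (g), 8] -/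
theorem noRealZeroOdd_fp_8339 :
    ∀ χ : DirichletCharacter ℂ 8339, χ.IsQuadratic → χ.IsPrimitive → χ.Odd →
      ∀ σ : ℝ, 0 < σ → σ < 1 → χ.LFunction σ ≠ 0 :=
  good_odd_of_odd_blk [31, 269] (by norm_num) (by decide) (by decide) 38 8 124 11 (by decide) (by decide) (by decide)
    (Or.inr (by decide +kernel))

set_option maxHeartbeats 400000 in
/-- `D = -8707`: the odd character `(·/8707)` of conductor `8707` (`8707`: prime) — Fekete–Pólya witness of order `6` along the induced modulus `8707·15 = 130605`, block certificate (digits of `86` bits, splitting depth `9`); est. `4.3` kernel-s. [cite: MontgomeryVaughan2007, §11.2.1 Exercises 7 (g), 8] -/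
theorem noRealZeroOdd_fp_8707 :
    ∀ χ : DirichletCharacter ℂ 8707, χ.IsQuadratic → χ.IsPrimitive → χ.Odd →
      ∀ σ : ℝ, 0 < σ → σ < 1 → χ.LFunction σ ≠ 0 :=
  good_odd_of_odd_blk [8707] (by norm_num) (by decide) (by decide) 15 6 86 9 (by decide) (by decide) (by decide)
    (Or.inr (by decide +kernel))

set_option maxHeartbeats 400000 in
/-- `D = -8979`: the odd character `(·/8979)` of conductor `8979` (`8979`: 3 · 41 · 73) — Fekete–Pólya witness of order `7` along the induced modulus `8979·34 = 305286`, block certificate (digits of `109` bits, splitting depth `11`); est. `11.2` kernel-s. [cite: MontgomeryVaughan2007, §11.2.1 Exercises 7 (g), 8] -/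
theorem noRealZeroOdd_fp_8979 :
    ∀ χ : DirichletCharacter ℂ 8979, χ.IsQuadratic → χ.IsPrimitive → χ.Odd →
      ∀ σ : ℝ, 0 < σ → σ < 1 → χ.LFunction σ ≠ 0 :=
  good_odd_of_odd_blk [3, 41, 73] (by norm_num) (by decide) (by decide) 34 7 109 11 (by decide) (by decide) (by decide)
    (Or.inr (by decide +kernel))

set_option maxHeartbeats 400000 in
/-- `D = -9195`: the odd character `(·/9195)` of conductor `9195` (`9195`: 3 · 5 · 613) — Fekete–Pólya witness of order `8` along the induced modulus `9195·14 = 128730`, block certificate (digits of `115` bits, splitting depth `9`); est. `5.6` kernel-s. [cite: MontgomeryVaughan2007, §11.2.1 Exercises 7 (g), 8] -/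
theorem noRealZeroOdd_fp_9195 :
    ∀ χ : DirichletCharacter ℂ 9195, χ.IsQuadratic → χ.IsPrimitive → χ.Odd →
      ∀ σ : ℝ, 0 < σ → σ < 1 → χ.LFunction σ ≠ 0 :=
  good_odd_of_odd_blk [3, 5, 613] (by norm_num) (by decide) (by decide) 14 8 115 9 (by decide) (by decide) (by decide)
    (Or.inr (by decide +kernel))

set_option maxHeartbeats 400000 in
/-- `D = 9497`: the even character `(·/9497)` of conductor `9497` (`9497`: prime) — Fekete–Pólya witness of order `8` along the induced modulus `9497·13 = 123461`, block certificate (digits of `113` bits, splitting depth `9`); est. `5.8` kernel-s. [cite: MontgomeryVaughan2007, §11.2.1 Exercises 7 (g), 8] -/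
theorem noRealZeroEven_fp_9497 :
    ∀ χ : DirichletCharacter ℂ 9497, χ.IsQuadratic → χ.IsPrimitive → χ.Even →
      ∀ σ : ℝ, 0 < σ → σ < 1 → χ.LFunction σ ≠ 0 :=
  good_even_of_odd_blk [9497] (by norm_num) (by decide) (by decide) 13 8 113 9 (by decide) (by decide) (by decide)
    (Or.inr (by decide +kernel))

set_option maxHeartbeats 400000 in
/-- `D = -9507`: the odd character `(·/9507)` of conductor `9507` (`9507`: 3 · 3169) — Fekete–Pólya witness of order `3` along the induced modulus `9507·35 = 332745`, block certificate (digits of `44` bits, splitting depth `10`); est. `3.3` kernel-s. [cite: MontgomeryVaughan2007, §11.2.1 Exercises 7 (g), 8] -/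
theorem noRealZeroOdd_fp_9507 :
    ∀ χ : DirichletCharacter ℂ 9507, χ.IsQuadratic → χ.IsPrimitive → χ.Odd →
      ∀ σ : ℝ, 0 < σ → σ < 1 → χ.LFunction σ ≠ 0 :=
  good_odd_of_odd_blk [3, 3169] (by norm_num) (by decide) (by decide) 35 3 44 10 (by decide) (by decide) (by decide)
    (Or.inr (by decide +kernel))

set_option maxHeartbeats 400000 in
/-- `D = -9592`: the odd character `χ₈·(·/1199)` of conductor `9592` (`1199`: 11 · 109) — Fekete–Pólya witness of order `5` along the induced modulus `9592·15 = 143880`, block certificate (digits of `73` bits, splitting depth `10`); est. `3.5` kernel-s. [cite: MontgomeryVaughan2007, §11.2.1 Exercises 7 (g), 8] -/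
theorem noRealZeroOdd_fp_9592 :
    ∀ χ : DirichletCharacter ℂ 9592, χ.IsQuadratic → χ.IsPrimitive → χ.Odd →
      ∀ σ : ℝ, 0 < σ → σ < 1 → χ.LFunction σ ≠ 0 :=
  good_odd_of_eight_blk [11, 109] (by norm_num) (by decide) (by decide) 15 5 73 10 (by decide) (by decide) (by decide)
    (Or.inl (by decide +kernel)) (Or.inr (by decide +kernel))

end Literature.NumberTheory.LFunctions
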